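import Literature.AlgebraicGeometry.AbelianSchemes.TupleRelFacObjIso   -- ★ (mine) `facObjIso` six-clause file: imports, `pullback_map_fst_fst_congr_base`, `baseChange_baseChange_hom_comp_of_fac`
import HarnessLib

/-!
# Glue for the `facObjIso` currency: the comparison map of a stage spread is FORCED, the level sections it carries are the base-changed ones,
# and the `X` ∕ `X̂` ∕ Poincaré clauses of `facObjIso` stand alone (no polarisation, level or action needed on the stage family)

Topic `AlgebraicGeometry/AbelianSchemes`; namespace `Literature.AlgebraicGeometry.AbelianSchemes.AbelianSchemeOver`.  THEOREMS ONLY (no definition,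
no named fact, no instance, no notation, no `sorry`).  Cell hodgecm-mathlib (D-0151), P6 «MOD programme» (crux hLiu418 = stmt-HodgeConjecture-24832,
`--supports`, count-neutral); L4 `stub_GSPREAD` chain step (5) glue (B-p18 (g39) census c894dffb; LA4-plan DEAL v1).  Sequel of ★ `TupleRelFacObjIso`.
(1) ★ (s3) `LevelStructure.exists_stage_of_generic_overStage` returns its comparison map `G` only with `G ≫ pr₁ = pr₁` and the `IsBaseChangeVia` square;
§1 shows such a `G` IS `facObjIso⁻¹ ≫ pr₁` (maps into a fibre product are determined by their two projections), and §2 reads the level clause as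
«`φ.σᵢ ≫ facObjIso⁻¹ = (ψ ×_T G).σᵢ`» — the `hσ` input of ★ Layer A′ `tupleRel_id_of_iso_of_hatTransportOver` with `φ₂ := ψ.baseChange ℓ.left`.
(2) ★ `tupleRel_facObjIso_hom∕_inv` quantify a polarisation, a level structure and an action ON the stage family; under road (S♭) the stage family
`𝒜ₜ` carries at first only a dual pair, so §3 isolates the three structure-free clauses (`X` as group schemes, `X̂`, Poincaré) of
`(facObjIso ℓ 𝒜.X, facObjIso ℓ Â.X)` in both directions.  HC_CM is proved only modulo the printed citations until rung 0 closes; nothing here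
is about HC.

## References
* [GortzWedhorn2020] U. Görtz, T. Wedhorn, *Algebraic Geometry I*, 2nd ed. (2020), Prop. 4.16 (p. 101), Section (4.7) (pp. 107–108).
* [MumfordFogartyKirwan1994] D. Mumford, J. Fogarty, F. Kirwan, *Geometric Invariant Theory*, 3rd ed. (1994), Ch. 7 §2 Def. 7.1–7.3 (pp. 129–130).
-/

set_option autoImplicit false

noncomputable section

-- Mathlib's `Over`/pull-back API is stated across semireducible wrappers (as in the ★ `AbelianSchemes/*` files).
set_option backward.isDefEq.respectTransparency false

universe u

open CategoryTheory CategoryTheory.Limits AlgebraicGeometry MonoidalCategory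
open Literature.AlgebraicGeometry.Limits.OverFac (facObjIso facObjIso_inv_left_fst_fst facObjIso_inv_left_snd)
open Literature.AlgebraicGeometry.Limits (pullbackFacObjIso_hom_left_fst pullbackFacObjIso_hom_left_snd)

namespace Literature.AlgebraicGeometry.AbelianSchemes

namespace AbelianSchemeOver

variable {X : Scheme.{u}} {T G : Over X} (ℓ : G ⟶ T) (𝒜 : AbelianSchemeOver X)

/-! ### §1 The comparison map of a stage spread is forced -/

/-- **A map `M : 𝒜 ×_X G → 𝒜 ×_X T` over `ℓ` with `M ≫ pr₁ = pr₁` IS `facObjIso⁻¹ ≫ pr₁`** (maps into the fibre product `𝒜 ×_X T` are determined by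
their two projections; ★ `OverFac.facObjIso_inv_left_fst_fst` ∕ `_inv_left_snd`).  This pins the `G` returned by ★ (s3)
`LevelStructure.exists_stage_of_generic_overStage`. [cite: GortzWedhorn2020, Prop. 4.16 (p. 101)] -/
theorem eq_facObjIso_inv_left_comp_fst (M : (𝒜.baseChange G.hom).X.left ⟶ (𝒜.baseChange T.hom).X.left)
    (hM : M ≫ pullback.fst 𝒜.X.hom T.hom = pullback.fst 𝒜.X.hom G.hom) (hMw : M ≫ (𝒜.baseChange T.hom).X.hom = (𝒜.baseChange G.hom).X.hom ≫ ℓ.left) :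
    M = (facObjIso ℓ 𝒜.X).inv.left ≫ pullback.fst ((Over.pullback T.hom).obj 𝒜.X).hom ℓ.left := by
  apply pullback.hom_ext
  · rw [hM, Category.assoc, facObjIso_inv_left_fst_fst]
  · change M ≫ (𝒜.baseChange T.hom).X.hom = _
    have hc : pullback.fst ((Over.pullback T.hom).obj 𝒜.X).hom ℓ.left ≫ pullback.snd 𝒜.X.hom T.hom =
        pullback.snd ((Over.pullback T.hom).obj 𝒜.X).hom ℓ.left ≫ ℓ.left := pullback.condition
    rw [hMw, Category.assoc]
    erw [hc]
    rw [reassoc_of% (facObjIso_inv_left_snd ℓ 𝒜.X)]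
    rfl

/-! ### §2 The level sections carried by such a map are the base-changed ones -/

/-- **LEVEL READING OF A STAGE SPREAD**: if `φ` (on `𝒜 ×_X G`) is the base change of `ψ` (on `𝒜 ×_X T`) along `ℓ` via a map `M` with `M ≫ pr₁ = pr₁`
(the output of ★ (s3) `LevelStructure.exists_stage_of_generic_overStage`), then `φ.σᵢ ≫ facObjIso⁻¹ = (ψ ×_T G).σᵢ` as sections of `(𝒜 ×_X T) ×_T G`
— the hypothesis `hσ` of ★ Layer A′ `tupleRel_id_of_iso_of_hatTransportOver` for the move `e := (facObjIso ℓ 𝒜.X)⁻¹`, `φ₂ := ψ.baseChange ℓ.left`.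
(Both sides are sections with projection `ℓ ≫ ψ.σᵢ` to `𝒜 ×_X T`: §1 + the section clause of `IsBaseChangeVia`, ★ `sectionBaseChange_left_comp_fst`.)
[cite: MumfordFogartyKirwan1994, Ch. 7 §2 Definitions 7.1 and 7.2 (p. 129)] [cite: GortzWedhorn2020, Prop. 4.16 (p. 101)] -/
theorem levelSection_comp_facObjIso_inv_eq_baseChange {g n : ℕ} (φ : (𝒜.baseChange G.hom).LevelStructure g n)
    (ψ : (𝒜.baseChange T.hom).LevelStructure g n) {M : (𝒜.baseChange G.hom).X.left ⟶ (𝒜.baseChange T.hom).X.left}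
    (h : φ.IsBaseChangeVia ψ ℓ.left M) (hM : M ≫ pullback.fst 𝒜.X.hom T.hom = pullback.fst 𝒜.X.hom G.hom) (i : Fin g ⊕ Fin g) :
    φ.σ i ≫ (facObjIso ℓ 𝒜.X).inv = (ψ.baseChange ℓ.left).σ i := by
  obtain ⟨⟨w, -, -, -⟩, hσ⟩ := h
  have hMe := eq_facObjIso_inv_left_comp_fst ℓ 𝒜 M hM w
  have h1 : ((ψ.baseChange ℓ.left).σ i).left ≫ pullback.fst (pullback.snd 𝒜.X.hom T.hom) ℓ.left = ℓ.left ≫ (ψ.σ i).left :=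
    (𝒜.baseChange T.hom).sectionBaseChange_left_comp_fst ℓ.left (ψ.σ i)
  apply Over.OverMorphism.ext
  rw [Over.comp_left]
  apply pullback.hom_ext
  · rw [Category.assoc]
    erw [h1]
    have h2 : (φ.σ i).left ≫ M = ℓ.left ≫ (ψ.σ i).left := hσ i
    rw [hMe] at h2
    exact h2
  · rw [Category.assoc]
    erw [facObjIso_inv_left_snd ℓ 𝒜.X]
    exact (Over.w (φ.σ i)).trans (Over.w ((ψ.baseChange ℓ.left).σ i)).symm

/-! ### §3 The structure-free clauses of `facObjIso`: `X` (as group schemes), `X̂`, Poincaré — both directions -/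

/-- **`facObjIso ℓ 𝒜.X : (𝒜 ×_X T) ×_T G → 𝒜 ×_X G` is a base change of GROUP SCHEMES along `𝟙 G`** (★ `isBaseChangeVia_id_of_isMonHom` with ★
`isMonHom_facObjIso_hom`, instances read on the `baseChange` spellings). [cite: MumfordFogartyKirwan1994, Ch. 7 §2 Definition 7.3 (p. 130)] -/
theorem baseChange_baseChange_isBaseChangeVia_id_facObjIso_hom :
    ((𝒜.baseChange T.hom).baseChange ℓ.left).IsBaseChangeVia (𝒜.baseChange G.hom) (𝟙 G.left) (facObjIso ℓ 𝒜.X).hom.left := by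
  haveI : IsMonHom (M := ((𝒜.baseChange T.hom).baseChange ℓ.left).X) (N := (𝒜.baseChange G.hom).X) (facObjIso ℓ 𝒜.X).hom :=
    isMonHom_facObjIso_hom ℓ 𝒜.X
  exact isBaseChangeVia_id_of_isMonHom ((𝒜.baseChange T.hom).baseChange ℓ.left) (𝒜.baseChange G.hom) (facObjIso ℓ 𝒜.X).hom

/-- **… and `facObjIso⁻¹ : 𝒜 ×_X G → (𝒜 ×_X T) ×_T G` likewise** (★ `isMonHom_facObjIso_inv`). [cite: MumfordFogartyKirwan1994, Ch. 7 §2 Definition 7.3 (p. 130)] -/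
theorem baseChange_isBaseChangeVia_id_facObjIso_inv :
    (𝒜.baseChange G.hom).IsBaseChangeVia ((𝒜.baseChange T.hom).baseChange ℓ.left) (𝟙 G.left) (facObjIso ℓ 𝒜.X).inv.left := by
  haveI : IsMonHom (M := (𝒜.baseChange G.hom).X) (N := ((𝒜.baseChange T.hom).baseChange ℓ.left).X) (facObjIso ℓ 𝒜.X).inv :=
    isMonHom_facObjIso_inv ℓ 𝒜.X
  exact isBaseChangeVia_id_of_isMonHom (𝒜.baseChange G.hom) ((𝒜.baseChange T.hom).baseChange ℓ.left) (facObjIso ℓ 𝒜.X).inv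

/-- **The Poincaré clause of `(facObjIso ℓ 𝒜.X, facObjIso ℓ Â.X)` ALONE** (no polarisation, level or action on `𝒜`): for a dual pair `D = (Â, 𝒫)` of `𝒜`,
`(facObjIso × facObjIso)^* 𝒫_G ≅ (𝒫_T)_ℓ` — both sheaves are pull-backs of `𝒫` along maps to `𝒜 ×_X Â` that agree after `facObjIso` (★
`DualPair.nonempty_pullback_map_iso_of_comp_eq` with ★ `pullbackFacObjIso_hom_left_fst`; the iterated clause re-read along `G.hom` by ★ `pullback_map_fst_fst_congr_base`).
[cite: MumfordFogartyKirwan1994, Ch. 7 §2 Definition 7.2 (p. 129)] [cite: GortzWedhorn2020, Section (4.7) (pp. 107–108)] -/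
theorem nonempty_pullback_map_facObjIso_hom_P_iso (D : 𝒜.DualPair)
    (wG : ((𝒜.baseChange T.hom).baseChange ℓ.left).X.hom ≫ 𝟙 G.left = (facObjIso ℓ 𝒜.X).hom.left ≫ (𝒜.baseChange G.hom).X.hom)
    (wĜ : ((D.baseChange T.hom).baseChange ℓ.left).hat.X.hom ≫ 𝟙 G.left = (facObjIso ℓ D.hat.X).hom.left ≫ (D.baseChange G.hom).hat.X.hom) :
    Nonempty ((Scheme.Modules.pullback
      (pullback.map ((𝒜.baseChange T.hom).baseChange ℓ.left).X.hom ((D.baseChange T.hom).baseChange ℓ.left).hat.X.hom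
        (𝒜.baseChange G.hom).X.hom (D.baseChange G.hom).hat.X.hom (facObjIso ℓ 𝒜.X).hom.left (facObjIso ℓ D.hat.X).hom.left
        (𝟙 G.left) wG wĜ)).obj (D.baseChange G.hom).P ≅ ((D.baseChange T.hom).baseChange ℓ.left).P) := by
  have wAb : (𝒜.baseChange G.hom).X.hom ≫ G.hom = pullback.fst 𝒜.X.hom G.hom ≫ 𝒜.X.hom := pullback.condition.symm
  have wHb : (D.baseChange G.hom).hat.X.hom ≫ G.hom = pullback.fst D.hat.X.hom G.hom ≫ D.hat.X.hom := pullback.condition.symm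
  obtain ⟨eb⟩ := D.nonempty_pullback_map_P_iso_baseChange_P G.hom wAb wHb
  obtain ⟨e₂⟩ := DualPair.nonempty_pullback_map_P_iso_baseChange_baseChange_P 𝒜 D T.hom ℓ.left
  have e₂' : (Scheme.Modules.pullback (pullback.map ((𝒜.baseChange T.hom).baseChange ℓ.left).X.hom
      ((D.baseChange T.hom).baseChange ℓ.left).hat.X.hom 𝒜.X.hom D.hat.X.hom
      (pullback.fst (pullback.snd 𝒜.X.hom T.hom) ℓ.left ≫ pullback.fst 𝒜.X.hom T.hom)
      (pullback.fst (pullback.snd D.hat.X.hom T.hom) ℓ.left ≫ pullback.fst D.hat.X.hom T.hom) G.hom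
      (baseChange_baseChange_hom_comp_of_fac ℓ 𝒜) (baseChange_baseChange_hom_comp_of_fac ℓ D.hat))).obj D.P ≅
      ((D.baseChange T.hom).baseChange ℓ.left).P :=
    (Scheme.Modules.pullbackCongr (pullback_map_fst_fst_congr_base ℓ 𝒜 D)).app D.P ≪≫ e₂
  exact DualPair.nonempty_pullback_map_iso_of_comp_eq D (D.baseChange G.hom) ((D.baseChange T.hom).baseChange ℓ.left)
    wAb wHb (baseChange_baseChange_hom_comp_of_fac ℓ 𝒜) (baseChange_baseChange_hom_comp_of_fac ℓ D.hat) eb e₂'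
    (pullbackFacObjIso_hom_left_fst T.hom ℓ.left G.hom (Over.w ℓ) 𝒜.X)
    (pullbackFacObjIso_hom_left_fst T.hom ℓ.left G.hom (Over.w ℓ) D.hat.X) wG wĜ

/-- **The Poincaré clause of `(facObjIso⁻¹, facObjIso⁻¹)` ALONE**: `(facObjIso⁻¹ × facObjIso⁻¹)^* (𝒫_T)_ℓ ≅ 𝒫_G`.
[cite: MumfordFogartyKirwan1994, Ch. 7 §2 Definition 7.2 (p. 129)] [cite: GortzWedhorn2020, Section (4.7) (pp. 107–108)] -/
theorem nonempty_pullback_map_facObjIso_inv_P_iso (D : 𝒜.DualPair)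
    (wG : (𝒜.baseChange G.hom).X.hom ≫ 𝟙 G.left = (facObjIso ℓ 𝒜.X).inv.left ≫ ((𝒜.baseChange T.hom).baseChange ℓ.left).X.hom)
    (wĜ : (D.baseChange G.hom).hat.X.hom ≫ 𝟙 G.left = (facObjIso ℓ D.hat.X).inv.left ≫ ((D.baseChange T.hom).baseChange ℓ.left).hat.X.hom) :
    Nonempty ((Scheme.Modules.pullback
      (pullback.map (𝒜.baseChange G.hom).X.hom (D.baseChange G.hom).hat.X.hom ((𝒜.baseChange T.hom).baseChange ℓ.left).X.hom
        ((D.baseChange T.hom).baseChange ℓ.left).hat.X.hom (facObjIso ℓ 𝒜.X).inv.left (facObjIso ℓ D.hat.X).inv.left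
        (𝟙 G.left) wG wĜ)).obj ((D.baseChange T.hom).baseChange ℓ.left).P ≅ (D.baseChange G.hom).P) := by
  have wAb : (𝒜.baseChange G.hom).X.hom ≫ G.hom = pullback.fst 𝒜.X.hom G.hom ≫ 𝒜.X.hom := pullback.condition.symm
  have wHb : (D.baseChange G.hom).hat.X.hom ≫ G.hom = pullback.fst D.hat.X.hom G.hom ≫ D.hat.X.hom := pullback.condition.symm
  obtain ⟨eb⟩ := D.nonempty_pullback_map_P_iso_baseChange_P G.hom wAb wHb
  obtain ⟨e₂⟩ := DualPair.nonempty_pullback_map_P_iso_baseChange_baseChange_P 𝒜 D T.hom ℓ.left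
  have e₂' : (Scheme.Modules.pullback (pullback.map ((𝒜.baseChange T.hom).baseChange ℓ.left).X.hom
      ((D.baseChange T.hom).baseChange ℓ.left).hat.X.hom 𝒜.X.hom D.hat.X.hom
      (pullback.fst (pullback.snd 𝒜.X.hom T.hom) ℓ.left ≫ pullback.fst 𝒜.X.hom T.hom)
      (pullback.fst (pullback.snd D.hat.X.hom T.hom) ℓ.left ≫ pullback.fst D.hat.X.hom T.hom) G.hom
      (baseChange_baseChange_hom_comp_of_fac ℓ 𝒜) (baseChange_baseChange_hom_comp_of_fac ℓ D.hat))).obj D.P ≅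
      ((D.baseChange T.hom).baseChange ℓ.left).P :=
    (Scheme.Modules.pullbackCongr (pullback_map_fst_fst_congr_base ℓ 𝒜 D)).app D.P ≪≫ e₂
  exact DualPair.nonempty_pullback_map_iso_of_comp_eq D ((D.baseChange T.hom).baseChange ℓ.left) (D.baseChange G.hom)
    (baseChange_baseChange_hom_comp_of_fac ℓ 𝒜) (baseChange_baseChange_hom_comp_of_fac ℓ D.hat) wAb wHb e₂' eb
    (facObjIso_inv_left_fst_fst ℓ 𝒜.X) (facObjIso_inv_left_fst_fst ℓ D.hat.X) wG wĜ

end AbelianSchemeOver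

end Literature.AlgebraicGeometry.AbelianSchemes

end
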